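import Summits.KontsevichZagierPeriods.KontsevichZagierPeriods.Theorems.SoloBlindLemniscate
import Summits.KontsevichZagierPeriods.KontsevichZagierPeriods.Theorems.SoloBlindSector
import Summits.KontsevichZagierPeriods.KontsevichZagierPeriods.Theorems.SoloBlindTransfer
import Literature.NumberTheory.Transcendental.KontsevichZagierGammaProofs
import Mathlib.RingTheory.AlgebraicIndependent.AlgebraicClosure
import HarnessLib

/-!
# The lemniscate sector: an unconditional rank-two sector of the Kontsevich–Zagier conjecture

With the sector principle of `SoloBlindSector` (`kz_sector`: if the periods of a family of
classes `g : ι → Q` are algebraically independent over `ℚ̄ ∩ ℝ`, the Kontsevich–Zagier conjecture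
holds for all representations whose classes are `ℚ̄`-polynomials in the `g i`):

**The lemniscate sector** (`lemniscateSector`, `kz_lemniscateSector`). With `g = ([A₂], [B₂])`, the
classes of the ℚ-rational representations of Euler's `a = ∫₀¹dx/√(1-x⁴)`, `b = ∫₀¹x²dx/√(1-x⁴)`
(`SoloBlindLemniscateReps`): by Euler's relation inside the rules (`lemniscate_euler`:
`[A₂][B₂] = [π/4]`) and Chudnovsky's theorem (tree:
`algebraicIndependent_real_pi_gamma_one_quarter`),
`a` and `b` are algebraically independent (`algebraicIndependent_lemniscate_pair`:
`π = 4ab`, `Γ(¼)⁴ = 128a³b`), so the conjecture holds UNCONDITIONALLY on the rank-two sector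
`M(A₂,B₂) ⊋ M_π ⊇ B(π), Z(ζ(2))` (`piSector_le_lemniscateSector`). This is the first sector of
transcendence degree two, and the first containing an elliptic period, on which the conjecture is
a theorem in this series.

References: G. V. Chudnovsky, *Contributions to the theory of transcendental numbers* (1984),
Ch. 7 Cor. 2.3; M. Waldschmidt, *Elliptic functions and transcendence* (2008), Cor. 33;
M. Kontsevich, D. Zagier, *Periods* (2001), §1.2.
-/

noncomputable section

namespace Summit.KontsevichZagierPeriods.KontsevichZagierPeriods.Theorems

open Set MeasureTheory
open Literature.NumberTheory.Transcendental
open Literature.NumberTheory.Transcendental.KZ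

namespace SoloBlind

/-! ## The lemniscate pair is algebraically independent -/

/-- `Γ(¼)⁴ = 128 a³ b`. -/
theorem Gamma_quarter_pow_four :
    Real.Gamma (1 / 4) ^ 4 = 128 * lemnA2.value ^ 3 * lemnB2.value := by
  have hab := lemnA2_value_mul_lemnB2_value
  have hs : Real.sqrt (2 * Real.pi) ^ 2 = 2 * Real.pi := Real.sq_sqrt (by positivity)
  have hs0 : Real.sqrt (2 * Real.pi) ≠ 0 := by positivity
  have hG2 : Real.Gamma (1 / 4) ^ 2 = 4 * lemnA2.value * Real.sqrt (2 * Real.pi) := by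
    rw [lemnA2_value]
    field_simp
  calc Real.Gamma (1 / 4) ^ 4 = (Real.Gamma (1 / 4) ^ 2) ^ 2 := by ring
    _ = 16 * lemnA2.value ^ 2 * Real.sqrt (2 * Real.pi) ^ 2 := by rw [hG2]; ring
    _ = 128 * lemnA2.value ^ 3 * lemnB2.value := by
      rw [hs]
      linear_combination (-128 * lemnA2.value ^ 2) * hab

/-- **`a = ∫₀¹dx/√(1-x⁴)` and `b = ∫₀¹x²dx/√(1-x⁴)` are algebraically independent over `ℚ`**
(from Chudnovsky's `π, Γ(¼)`: `π = 4ab` and `Γ(¼)⁴ = 128a³b` lie in `ℚ(a,b)`). -/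
theorem algebraicIndependent_lemniscate_pair :
    AlgebraicIndependent ℚ ![lemnA2.value, lemnB2.value] := by
  set K : IntermediateField ℚ ℝ :=
    IntermediateField.adjoin ℚ ({lemnA2.value, lemnB2.value} : Set ℝ) with hK
  have haK : lemnA2.value ∈ K := IntermediateField.subset_adjoin ℚ _ (by simp)
  have hbK : lemnB2.value ∈ K := IntermediateField.subset_adjoin ℚ _ (by simp)
  have hnat : ∀ n : ℕ, (n : ℝ) ∈ K := fun n => natCast_mem K n
  have hπK : Real.pi ∈ K := by
    rw [show Real.pi = (4 : ℕ) * (lemnA2.value * lemnB2.value) by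
      rw [lemnA2_value_mul_lemnB2_value]; push_cast; ring]
    exact mul_mem (hnat 4) (mul_mem haK hbK)
  have hGK : Real.Gamma (1 / 4) ^ 4 ∈ K := by
    rw [Gamma_quarter_pow_four, show (128 : ℝ) = (128 : ℕ) by norm_num]
    exact mul_mem (mul_mem (hnat 128) (pow_mem haK 3)) hbK
  exact algebraicIndependent_pair_of_pow_mem_adjoin algebraicIndependent_real_pi_gamma_one_quarter
    one_pos (by norm_num : 0 < 4) ((pow_one Real.pi).symm ▸ hπK) hGK

/-- In particular `a` is transcendental. -/
theorem transcendental_lemnA2_value : Transcendental ℚ lemnA2.value := by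
  simpa using algebraicIndependent_lemniscate_pair.transcendental 0

/-- In particular `b` is transcendental. -/
theorem transcendental_lemnB2_value : Transcendental ℚ lemnB2.value := by
  simpa using algebraicIndependent_lemniscate_pair.transcendental 1

/-! ## The lemniscate sector -/

/-- The two generating classes `[A₂], [B₂]`. -/
def lemnGen : Fin 2 → Q := ![mkQ (of lemnA2), mkQ (of lemnB2)]

/-- `lemnGen 0 = [A₂]`. -/
@[simp] theorem lemnGen_zero : lemnGen 0 = mkQ (of lemnA2) := rfl

/-- `lemnGen 1 = [B₂]`. -/
@[simp] theorem lemnGen_one : lemnGen 1 = mkQ (of lemnB2) := rfl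

/-- The periods of the generating classes are `a, b`. -/
theorem evalQ_lemnGen : (fun i => evalQ (lemnGen i)) = ![lemnA2.value, lemnB2.value] := by
  funext i
  fin_cases i
  · simp [evalQ_mkQ, eval_of]
  · simp [evalQ_mkQ, eval_of]

/-- The periods `a, b` of the generating classes are algebraically independent over `ℚ̄ ∩ ℝ`. -/
theorem algebraicIndependent_evalQ_lemnGen :
    AlgebraicIndependent K₀ fun i => evalQ (lemnGen i) := by
  rw [evalQ_lemnGen]
  exact algebraicIndependent_lemniscate_pair.algebraicClosure

/-- `[A₂]` and `[B₂]` are algebraically independent over `ℚ̄ ∩ ℝ` in `Q`. -/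
theorem algebraicIndependent_lemnGen : AlgebraicIndependent K₀ lemnGen :=
  algebraicIndependent_of_evalQ algebraicIndependent_evalQ_lemnGen

/-- **The lemniscate sector** `M(A₂,B₂)`: all formal combinations of integral representations
whose class modulo the moves is a `ℚ̄`-polynomial in `[A₂]` and `[B₂]`. -/
def lemniscateSector : NonUnitalSubring FormalRep := sector (range lemnGen)

/-- Membership in the lemniscate sector, unfolded. -/
theorem mem_lemniscateSector {z : FormalRep} :
    z ∈ lemniscateSector ↔ mkQ z ∈ Algebra.adjoin K₀ (range lemnGen) := Iff.rfl

/-- `A₂` lies in the lemniscate sector. -/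
theorem of_lemnA2_mem_lemniscateSector : of lemnA2 ∈ lemniscateSector :=
  mem_lemniscateSector.mpr (Algebra.subset_adjoin (mem_range_self (f := lemnGen) 0))

/-- `B₂` lies in the lemniscate sector. -/
theorem of_lemnB2_mem_lemniscateSector : of lemnB2 ∈ lemniscateSector :=
  mem_lemniscateSector.mpr (Algebra.subset_adjoin (mem_range_self (f := lemnGen) 1))

/-- `x_π = 4[A₂][B₂]` lies in `ℚ̄[[A₂],[B₂]]` (Euler's relation inside the rules). -/
theorem xPi_mem_adjoin_lemnGen : xPi ∈ Algebra.adjoin K₀ (range lemnGen) := by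
  have h : xPi = (4 : K₀) • (lemnGen 0 * lemnGen 1) := by
    rw [lemnGen_zero, lemnGen_one, lemniscate_euler]
    rfl
  rw [h]
  exact Subalgebra.smul_mem _ (mul_mem (Algebra.subset_adjoin (mem_range_self 0))
    (Algebra.subset_adjoin (mem_range_self 1))) _

/-- **`M_π ⊆ M(A₂,B₂)`**: the tame `π`-sector (hence `B(π)` and the `ζ(2)`-ring) lies in the
lemniscate sector. -/
theorem piSector_le_lemniscateSector : piSector ≤ lemniscateSector := fun _ hz =>
  Algebra.adjoin_le (singleton_subset_iff.mpr xPi_mem_adjoin_lemnGen) hz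

/-- `B(π) ⊆ M(A₂,B₂)`. -/
theorem lineRing_pi_le_lemniscateSector : lineRing Real.pi ≤ lemniscateSector :=
  lineRing_pi_le_piSector.trans piSector_le_lemniscateSector

/-- **`A₂ ∉ M_π`: the lemniscate sector is strictly bigger than the tame `π`-sector** (no
`ℚ̄`-polynomial in `x_π` is the class of `A₂`). -/
theorem of_lemnA2_not_mem_piSector : of lemnA2 ∉ piSector := by
  intro h
  rw [mem_piSector, Algebra.adjoin_singleton_eq_range_aeval, AlgHom.mem_range] at h
  obtain ⟨p, hp⟩ := h
  have hx : (4 : Q) * (lemnGen 0 * lemnGen 1) = xPi := by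
    rw [lemnGen_zero, lemnGen_one, lemniscate_euler, xPi, Algebra.smul_def, map_ofNat]
  -- the polynomial `X₀ - p(4X₀X₁)` over `K₀` vanishes at `([A₂],[B₂])`, hence is `0`
  set c : MvPolynomial (Fin 2) K₀ := 4 * (MvPolynomial.X 0 * MvPolynomial.X 1) with hc
  have hPg : MvPolynomial.aeval lemnGen (MvPolynomial.X 0 - Polynomial.aeval c p) = 0 := by
    rw [map_sub, MvPolynomial.aeval_X, ← Polynomial.aeval_algHom_apply, hc, map_mul, map_mul,
      MvPolynomial.aeval_X, MvPolynomial.aeval_X, map_ofNat, hx, hp, lemnGen_zero, sub_self]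
  have hP0 := (algebraicIndependent_iff.mp algebraicIndependent_lemnGen) _ hPg
  -- evaluating at `(t, 0)`: `t = p(0)` for every `t`
  have hev : ∀ t : K₀, t - Polynomial.aeval (0 : K₀) p = 0 := fun t => by
    have h1 := congrArg (MvPolynomial.aeval (![t, 0] : Fin 2 → K₀)) hP0
    rw [map_sub, MvPolynomial.aeval_X, ← Polynomial.aeval_algHom_apply, hc, map_mul, map_mul,
      MvPolynomial.aeval_X, MvPolynomial.aeval_X, map_zero, map_ofNat] at h1
    simpa using h1
  exact one_ne_zero ((sub_eq_zero.mp (hev 1)).trans (sub_eq_zero.mp (hev 0)).symm)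

/-- **The lemniscate-sector kernel theorem (unconditional).** An element of the lemniscate sector
with period `0` is a consequence of the three rules. -/
theorem lemniscateSector_kernel {z : FormalRep} (hz : z ∈ lemniscateSector) (h0 : eval z = 0) :
    z ∈ relations :=
  sector_kernel algebraicIndependent_evalQ_lemnGen hz h0

/-- **The Kontsevich–Zagier conjecture on the lemniscate sector (unconditional).** Two integral
representations in `M(A₂,B₂)` — e.g. any products of `A₂`, `B₂`, representations in `B(π)` and
the `ζ(2)`-ring, in any dimensions — with the same period are equivalent under the rules. -/
theorem kz_lemniscateSector {n m : ℕ} (r : IntegralRep n) (r' : IntegralRep m)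
    (hr : of r ∈ lemniscateSector) (hr' : of r' ∈ lemniscateSector) (hv : r.value = r'.value) :
    Equivalent r r' :=
  kz_sector algebraicIndependent_evalQ_lemnGen r r' hr hr' hv

/-- Example: `A₂ × B₂ × Z` (`Z` = Kontsevich–Zagier's `ζ(2)`, six-dimensional, period `π³/24`)
and `S × A₂ × B₂` (`S` = the unit-square representation of `π²/6`) are KZ-equivalent. -/
theorem kz_lemniscate_zetaTwo :
    Equivalent ((lemnA2.prod lemnB2).prod zetaTwoRep)
      ((unitSquareRep.prod lemnA2).prod lemnB2) := by
  have hA := of_lemnA2_mem_lemniscateSector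
  have hB := of_lemnB2_mem_lemniscateSector
  have hZ : of zetaTwoRep ∈ lemniscateSector :=
    piSector_le_lemniscateSector of_zetaTwoRep_mem_piSector
  have hS : of unitSquareRep ∈ lemniscateSector :=
    piSector_le_lemniscateSector of_unitSquareRep_mem_piSector
  refine kz_lemniscateSector _ _ ?_ ?_ ?_
  · rw [← of_mul_of, ← of_mul_of]
    exact mul_mem (mul_mem hA hB) hZ
  · rw [← of_mul_of, ← of_mul_of]
    exact mul_mem (mul_mem hS hA) hB
  · rw [IntegralRep.value_prod, IntegralRep.value_prod, IntegralRep.value_prod,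
      IntegralRep.value_prod, unitSquareRep_value, zetaTwoRep_value]
    ring

end SoloBlind

end Summit.KontsevichZagierPeriods.KontsevichZagierPeriods.Theorems
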